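import Mathlib
import HarnessLib

/-!
# Route MonotoneRestoration, crux `OrbitRestorationQP` (stmt-18293) — DIAGONAL GLUING SEES ODD CYCLES
# (certified example for the glued kill format; helper, def-free)

`…OrbitRestorationQPDoubleCoverBlindness.lean` (p826135) certifies that a matrix-symmetric polynomial takes equal values
at the `0/1` adjacency matrices of `K₃ ⊔ K₃` and of its bipartite double cover `C₆`.  The glued kill format
(`…OrbitRestorationQPGluedKill.lean`) evaluates instead at `a + 1_X` for a base point `a` fixed by the diagonal action,
e.g. `a = I`.  Here: the matrix-symmetric degree-4 polynomial
`P_n = Σ_{i,k,j,l} x_{ij} x_{kj} x_{kl} x_{il}` (the homomorphism polynomial of the bipartite 4-cycle, `= Σ_{i,k} ((XXᵀ)_{ik})²`)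
* is invariant under independent row and column permutations (`rename_fourCycle`);
* takes the SAME value `36` at the adjacency matrices of `2K₃` and `C₆` (`eval_fourCycle_adj_eq`: blind at `0/1` points);
* takes the values `162 ≠ 114` at `I + 1_{2K₃}` and `I + 1_{C₆}` (`eval_fourCycle_glued_ne`): through the marked
  diagonal the two-sorted structure remembers the one-sorted graph, and `tr N³` (triangles) enters `tr (I+N)⁴`.
So the glued witness class of `GluedKill.orbitRestorationQP_false_of_diagonalGluedSeparating` is strictly larger than the
`0/1` class already at the level of single polynomials.  Honest label: a 6 × 6 computation; nothing closed. [folklore]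
-/

-- `Summit.ValiantsHypothesis.ValiantsHypothesis.…` is the tree's mandated namespace (Sub = Summit).
set_option linter.dupNamespace false

namespace Summit.ValiantsHypothesis.ValiantsHypothesis.Theorems

namespace GluedKill

open MvPolynomial

/-- **Matrix symmetry of the 4-cycle polynomial** `Σ_{i,k,j,l} x_{ij} x_{kj} x_{kl} x_{il}`. [folklore] -/
theorem rename_fourCycle (n : ℕ) (σ τ : Equiv.Perm (Fin n)) :
    rename (fun p : Fin n × Fin n => (σ p.1, τ p.2))
      (∑ i : Fin n, ∑ k : Fin n, ∑ j : Fin n, ∑ l : Fin n,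
        X (i, j) * X (k, j) * X (k, l) * X (i, l) : MvPolynomial (Fin n × Fin n) ℂ) =
      ∑ i : Fin n, ∑ k : Fin n, ∑ j : Fin n, ∑ l : Fin n, X (i, j) * X (k, j) * X (k, l) * X (i, l) := by
  simp only [map_sum, map_mul, rename_X]
  refine (Equiv.sum_comp σ (fun i => ∑ k : Fin n, ∑ j : Fin n, ∑ l : Fin n,
      (X (i, τ j) * X (σ k, τ j) * X (σ k, τ l) * X (i, τ l) : MvPolynomial (Fin n × Fin n) ℂ))).trans ?_
  refine Finset.sum_congr rfl fun i _ => ?_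
  refine (Equiv.sum_comp σ (fun k => ∑ j : Fin n, ∑ l : Fin n,
      (X (i, τ j) * X (k, τ j) * X (k, τ l) * X (i, τ l) : MvPolynomial (Fin n × Fin n) ℂ))).trans ?_
  refine Finset.sum_congr rfl fun k _ => ?_
  refine (Equiv.sum_comp τ (fun j => ∑ l : Fin n,
      (X (i, j) * X (k, j) * X (k, τ l) * X (i, τ l) : MvPolynomial (Fin n × Fin n) ℂ))).trans ?_
  refine Finset.sum_congr rfl fun j _ => ?_
  exact Equiv.sum_comp τ (fun l => (X (i, j) * X (k, j) * X (k, l) * X (i, l) : MvPolynomial (Fin n × Fin n) ℂ))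

/-- The nested sum evaluates entrywise. [folklore] -/
theorem eval_fourCycle (n : ℕ) (v : Fin n × Fin n → ℂ) :
    eval v (∑ i : Fin n, ∑ k : Fin n, ∑ j : Fin n, ∑ l : Fin n,
        X (i, j) * X (k, j) * X (k, l) * X (i, l) : MvPolynomial (Fin n × Fin n) ℂ) =
      ∑ i : Fin n, ∑ k : Fin n, ∑ j : Fin n, ∑ l : Fin n, v (i, j) * v (k, j) * v (k, l) * v (i, l) := by
  simp only [map_sum, map_mul, eval_X]

/-- A natural-number-valued point, cast to `ℂ`: the 4-cycle sum is the cast of the natural-number sum. [folklore] -/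
theorem eval_fourCycle_natCast (n : ℕ) (w : Fin n × Fin n → ℕ) :
    eval (fun ij => (w ij : ℂ)) (∑ i : Fin n, ∑ k : Fin n, ∑ j : Fin n, ∑ l : Fin n,
        X (i, j) * X (k, j) * X (k, l) * X (i, l) : MvPolynomial (Fin n × Fin n) ℂ) =
      ((∑ i : Fin n, ∑ k : Fin n, ∑ j : Fin n, ∑ l : Fin n, w (i, j) * w (k, j) * w (k, l) * w (i, l) : ℕ) : ℂ) := by
  rw [eval_fourCycle]
  push_cast
  rfl

/-- **Blind at `0/1` points**: the 4-cycle polynomial takes the same value (`36`) at the adjacency matrices of `2K₃`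
(vertices `{0,1,2}` and `{3,4,5}`) and of the 6-cycle `C₆` (`i ~ i ± 1 mod 6`). [folklore] -/
theorem eval_fourCycle_adj_eq :
    eval (fun ij : Fin 6 × Fin 6 => ((if ij.1 ≠ ij.2 ∧ ij.1.val / 3 = ij.2.val / 3 then 1 else 0 : ℕ) : ℂ))
        (∑ i : Fin 6, ∑ k : Fin 6, ∑ j : Fin 6, ∑ l : Fin 6,
          X (i, j) * X (k, j) * X (k, l) * X (i, l) : MvPolynomial (Fin 6 × Fin 6) ℂ) =
      eval (fun ij : Fin 6 × Fin 6 =>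
          ((if (ij.1.val + 1) % 6 = ij.2.val ∨ (ij.2.val + 1) % 6 = ij.1.val then 1 else 0 : ℕ) : ℂ))
        (∑ i : Fin 6, ∑ k : Fin 6, ∑ j : Fin 6, ∑ l : Fin 6,
          X (i, j) * X (k, j) * X (k, l) * X (i, l) : MvPolynomial (Fin 6 × Fin 6) ℂ) := by
  rw [eval_fourCycle_natCast, eval_fourCycle_natCast]
  norm_cast

/-- **Seen at the glued points**: at `I + 1_{2K₃}` and `I + 1_{C₆}` the 4-cycle polynomial takes the values `162` and
`114`. [folklore] -/
theorem eval_fourCycle_glued_ne :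
    eval (fun ij : Fin 6 × Fin 6 =>
          ((if ij.1 ≠ ij.2 ∧ ij.1.val / 3 = ij.2.val / 3 then 1 else 0 : ℕ) : ℂ) + (if ij.1 = ij.2 then 1 else 0))
        (∑ i : Fin 6, ∑ k : Fin 6, ∑ j : Fin 6, ∑ l : Fin 6,
          X (i, j) * X (k, j) * X (k, l) * X (i, l) : MvPolynomial (Fin 6 × Fin 6) ℂ) ≠
      eval (fun ij : Fin 6 × Fin 6 =>
          ((if (ij.1.val + 1) % 6 = ij.2.val ∨ (ij.2.val + 1) % 6 = ij.1.val then 1 else 0 : ℕ) : ℂ) +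
            (if ij.1 = ij.2 then 1 else 0))
        (∑ i : Fin 6, ∑ k : Fin 6, ∑ j : Fin 6, ∑ l : Fin 6,
          X (i, j) * X (k, j) * X (k, l) * X (i, l) : MvPolynomial (Fin 6 × Fin 6) ℂ) := by
  have h1 : (fun ij : Fin 6 × Fin 6 =>
      ((if ij.1 ≠ ij.2 ∧ ij.1.val / 3 = ij.2.val / 3 then 1 else 0 : ℕ) : ℂ) + (if ij.1 = ij.2 then 1 else 0)) =
      fun ij => (((if ij.1 ≠ ij.2 ∧ ij.1.val / 3 = ij.2.val / 3 then 1 else 0) + (if ij.1 = ij.2 then 1 else 0) : ℕ) : ℂ) := by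
    funext ij; push_cast; rfl
  have h2 : (fun ij : Fin 6 × Fin 6 =>
      ((if (ij.1.val + 1) % 6 = ij.2.val ∨ (ij.2.val + 1) % 6 = ij.1.val then 1 else 0 : ℕ) : ℂ) +
        (if ij.1 = ij.2 then 1 else 0)) =
      fun ij => (((if (ij.1.val + 1) % 6 = ij.2.val ∨ (ij.2.val + 1) % 6 = ij.1.val then 1 else 0) +
        (if ij.1 = ij.2 then 1 else 0) : ℕ) : ℂ) := by
    funext ij; push_cast; rfl
  rw [h1, h2, eval_fourCycle_natCast, eval_fourCycle_natCast]
  norm_cast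

end GluedKill

end Summit.ValiantsHypothesis.ValiantsHypothesis.Theorems
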